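import Summits.KontsevichZagierPeriods.KontsevichZagierPeriods.Theorems.LinRedNormalFormArrangementNormalFormStubRebaseSimplePosOneFibreCornerAssembly

/-!
# Stub `stub_rebaseSimplePosOneZero` (crux `ArrangementNormalForm`, line `janus-bands`) —
part `CornerOne`: the double-corner bands at `B = 1`

Corner toolkit for the double-corner bands at `B = 1`, seventh file: the two residual
hypotheses `Hdthick`, `Hdfar` of `rebaseSimplePos_oneFibre_of_double'` at `b = 0` (base
`(x, y) ∈ ℝ²`, one lettered fibre, letter sheared to `0`, transverse bounds `u < t < v` above
the `y`-free apex level `κ`, `u − κ = A (v − u)`, `A > 0`, thick regime `κ < 0 < u < v` or far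
regime `0 < κ`, `u < v`, `2κ ≤ v`, and a DOUBLE corner: a point `z₀` of the closed base cell with
`κ(z₀) = u(z₀) = v(z₀) = 0` lying on the pole line `y = ℓ₂(x)`) are discharged:
`rebaseSimplePos_dthick_one`, `rebaseSimplePos_dfar_one`. Proof (`RebasePos.good_dcorner`): a
`y`-free lower bound is the product case; otherwise the corner is the rational point
`(x₀, ℓ₂(x₀))`, `x₀ = −κ₀/κ₁`; cut the base cell by the pole line (rule 1a), normalise each side
by `RebasePos.cornerNormalize` (rule 2: corner to the origin, pole line to `y = 0`, cell into the
open quadrant) and conclude by `RebasePos.good_corner_norm`.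

References: M. Kontsevich, D. Zagier, *Periods* (2001), §1.2, rules (1a), (2).
-/

noncomputable section

open Set MeasureTheory MvPolynomial
open Literature.NumberTheory.Transcendental Literature.ModelTheory.ExponentialFields

namespace Summit.KontsevichZagierPeriods.ArrangementNormalForm.JanusBands

namespace RebasePos

open SeparatePos

section DCorner

variable {m m' : ℕ}

/-- The constant of a normalised form is the value of the form at the corner. -/
theorem normF_snd_cast (x₀ σ τ : ℚ) (ℓ₂ : (Fin 1 → ℚ) × ℚ) (c : (Fin (1 + 1) → ℚ) × ℚ)
    (z : Fin (1 + 1 + 1) → ℝ) (hx : z 0 = x₀) (hy : z 1 = (ℓ₂.1 0 : ℝ) * x₀ + ℓ₂.2) :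
    ((normF x₀ σ τ ℓ₂ c).2 : ℝ) = affF 1 1 c z := by
  rw [affF_two, hx, hy, normF]
  push_cast
  ring

/-- The pole row `y − ℓ₂(x)`. -/
def poleRow (ℓ₂ : (Fin 1 → ℚ) × ℚ) : (Fin (1 + 1) → ℚ) × ℚ := (![-ℓ₂.1 0, 1], -ℓ₂.2)

/-- The pole row evaluated. -/
theorem affF_poleRow (ℓ₂ : (Fin 1 → ℚ) × ℚ) (z : Fin (1 + 1 + 1) → ℝ) :
    affF 1 1 (poleRow ℓ₂) z = z 1 - affB 1 1 ℓ₂ z := by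
  rw [affF_two, affB_two, poleRow]
  simp
  ring

/-- The sign putting the base cell to the right of the corner. -/
theorem exists_sign (far : Bool) (M : Fin m' → (Fin (1 + 1) → ℚ) × ℚ) (κ u v : (Fin (1 + 1) → ℚ) × ℚ)
    (x₀ : ℚ) (hk : κ.1 0 ≠ 0)
    (hκz : ∀ z : Fin (1 + 1 + 1) → ℝ, affF 1 1 κ z = (κ.1 0 : ℝ) * (z 0 - x₀))
    (hcell : ∀ z : Fin (1 + 1 + 1) → ℝ, (∀ j, 0 < affF 1 1 (M j) z) →
      bif far then (0 < affF 1 1 κ z ∧ affF 1 1 u z < affF 1 1 v z ∧ 2 * affF 1 1 κ z ≤ affF 1 1 v z)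
      else (affF 1 1 κ z < 0 ∧ 0 < affF 1 1 u z ∧ affF 1 1 u z < affF 1 1 v z)) :
    ∃ σ : ℚ, σ * σ = 1 ∧ ∀ z : Fin (1 + 1 + 1) → ℝ, (∀ j, 0 < affF 1 1 (M j) z) → 0 < (σ : ℝ) * (z 0 - x₀) := by
  rcases lt_or_gt_of_ne hk with hkn | hkp
  · have hkn' : ((κ.1 0 : ℚ) : ℝ) < 0 := by exact_mod_cast hkn
    cases far
    · refine ⟨1, by norm_num, fun z hz => ?_⟩
      have h := (hcell z hz).1
      rw [hκz] at h
      push_cast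
      nlinarith
    · refine ⟨-1, by norm_num, fun z hz => ?_⟩
      have h := (hcell z hz).1
      rw [hκz] at h
      push_cast
      nlinarith
  · have hkp' : (0 : ℝ) < ((κ.1 0 : ℚ) : ℝ) := by exact_mod_cast hkp
    cases far
    · refine ⟨-1, by norm_num, fun z hz => ?_⟩
      have h := (hcell z hz).1
      rw [hκz] at h
      push_cast
      nlinarith
    · refine ⟨1, by norm_num, fun z hz => ?_⟩
      have h := (hcell z hz).1
      rw [hκz] at h
      push_cast
      nlinarith

variable (L : Fin m → (Fin 1 → ℚ) × ℚ) (e : Fin m → ℕ) (ℓ₁ ℓ₂ : (Fin 1 → ℚ) × ℚ)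

/-- **A double-corner band at `B = 1` is good** (both regimes). See the module docstring. -/
theorem good_dcorner (far : Bool) (s : KZ.IntegralRep (1 + 1 + 1)) (M : Fin m' → (Fin (1 + 1) → ℚ) × ℚ)
    (p : MvPolynomial (Fin 1) ℚ) (u v κ : (Fin (1 + 1) → ℚ) × ℚ) (A : ℚ)
    (hbd : Bornology.IsBounded s.domain)
    (hdom : s.domain = gDom 1 1 m' M (fun _ => Sum.inr u) (fun _ => Sum.inr v))
    (hint : EqOn s.integrand (glit 1 1 p L e ℓ₁ ℓ₂ 0 1 (fun _ => some 0)) s.domain)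
    (hκ : κ.1 (Fin.last 1) = 0) (hA : u - κ = A • (v - u)) (hA0 : 0 < A)
    (hcell : ∀ z : Fin (1 + 1 + 1) → ℝ, (∀ j, 0 < affF 1 1 (M j) z) →
      bif far then (0 < affF 1 1 κ z ∧ affF 1 1 u z < affF 1 1 v z ∧ 2 * affF 1 1 κ z ≤ affF 1 1 v z)
      else (affF 1 1 κ z < 0 ∧ 0 < affF 1 1 u z ∧ affF 1 1 u z < affF 1 1 v z))
    (hcorner : ∃ z ∈ closure {z : Fin (1 + 1 + 1) → ℝ | ∀ j, 0 < affF 1 1 (M j) z},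
      affF 1 1 κ z = 0 ∧ affF 1 1 u z = 0 ∧ affF 1 1 v z = 0 ∧
      z (Fin.castAdd 1 (Fin.last 1)) = affB 1 1 ℓ₂ z) :
    ∃ c ∈ AddSubgroup.closure (GGset 1 2 1), KZ.of s - c ∈ KZ.relations := by
  have hlast : (Fin.last 1 : Fin (1 + 1)) = 1 := rfl
  rw [hlast] at hκ
  -- a `y`-free lower bound: the product case
  by_cases huy : u.1 1 = 0
  · exact good_product (fun _ => some 0) (fun _ => u) (fun _ => v) s M L e p ℓ₁ ℓ₂ (fun _ => Sum.inr u)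
      (fun _ => Sum.inr v) (Or.inl rfl) hbd hdom hint (fun _ => rfl) (fun _ => rfl)
      fun _ c hc => Or.inl (by cases hc; simpa using huy)
  obtain ⟨z₀, hz₀, hκz, huz, hvz, hyz⟩ := hcorner
  rw [iy_eq] at hyz
  -- an empty cell is trivial
  by_cases hne : ∃ w : Fin (1 + 1 + 1) → ℝ, ∀ j, 0 < affF 1 1 (M j) w
  swap
  · push Not at hne
    refine good_of_null s ?_
    have he : s.domain = ∅ := by
      rw [hdom]
      exact Set.eq_empty_iff_forall_notMem.2 fun z hz => by
        rw [mem_gDom_one] at hz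
        obtain ⟨j, hj⟩ := hne z
        exact absurd (hz.1 j) (not_lt.2 hj)
    rw [he, measure_empty]
  obtain ⟨w₀, hw₀⟩ := hne
  have hk : κ.1 0 ≠ 0 := by
    intro hk
    have h := reg_ne far (hcell w₀ hw₀)
    rw [affF_two, hk, hκ] at h hκz
    simp only [Rat.cast_zero, zero_mul, zero_add, ne_eq] at h hκz
    exact h hκz
  -- the corner `(x₀, ℓ₂(x₀))`
  set x₀ : ℚ := -κ.2 / κ.1 0 with hx₀
  have hk' : ((κ.1 0 : ℚ) : ℝ) ≠ 0 := by exact_mod_cast hk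
  have hκform : ∀ z : Fin (1 + 1 + 1) → ℝ, affF 1 1 κ z = (κ.1 0 : ℝ) * (z 0 - x₀) := fun z => by
    rw [affF_two, hκ, hx₀]
    push_cast
    field_simp
    ring
  have hx₀R : z₀ 0 = x₀ := by
    rw [hκform] at hκz
    rcases mul_eq_zero.1 hκz with h | h
    · exact absurd h hk'
    · linarith
  have hy₀R : z₀ 1 = (ℓ₂.1 0 : ℝ) * x₀ + ℓ₂.2 := by rw [hyz, affB_two, hx₀R]
  have hM0 : ∀ j, 0 ≤ affF 1 1 (M j) z₀ := fun j =>
    le_of_closure_rows (M := M) continuous_const (continuous_affF (M j)) (fun z hz => (hz j).le) z₀ hz₀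
  obtain ⟨σ, hσ, hσpos⟩ := exists_sign far M κ u v x₀ hk hκform hcell
  have hσ' : (σ : ℝ) * σ = 1 := by exact_mod_cast hσ
  -- one side of the pole line, normalised
  have hside : ∀ (τ : ℚ) (s' : KZ.IntegralRep (1 + 1 + 1)), τ * τ = 1 → s'.domain ⊆ s.domain →
      s'.domain = gDom 1 1 (m' + 1) (Fin.snoc M (τ • poleRow ℓ₂)) (fun _ => Sum.inr u) (fun _ => Sum.inr v) →
      s'.integrand = s.integrand →
      ∃ c ∈ AddSubgroup.closure (GGset 1 2 1), KZ.of s' - c ∈ KZ.relations := by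
    intro τ s' hτ hsub hd' hi'
    have hτ' : (τ : ℝ) * τ = 1 := by exact_mod_cast hτ
    have hτ0 : τ ≠ 0 := fun h => by rw [h, zero_mul] at hτ; exact zero_ne_one hτ
    obtain ⟨s'', hbd'', hdom'', hint'', -, hrel⟩ := cornerNormalize x₀ σ τ ℓ₂ hσ hτ s' _ L e p ℓ₁ u v
      (hbd.subset hsub) hd' (by rw [hi']; exact hint.mono hsub)
    suffices hs'' : ∃ c ∈ AddSubgroup.closure (GGset 1 2 1), KZ.of s'' - c ∈ KZ.relations by
      obtain ⟨c₀, hc₀, hc₀'⟩ := hs''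
      exact ⟨c₀, hc₀, by have := add_mem hrel hc₀'; rwa [sub_add_sub_cancel] at this⟩
    have hrows : ∀ w : Fin (1 + 1 + 1) → ℝ,
        (∀ j, 0 < affF 1 1 (normF x₀ σ τ ℓ₂ ((Fin.snoc M (τ • poleRow ℓ₂) : Fin (m' + 1) → _) j)) w) →
        (∀ j, 0 < affF 1 1 (M j) (normMap x₀ σ τ ℓ₂ w)) ∧
          0 < (τ : ℝ) * affF 1 1 (poleRow ℓ₂) (normMap x₀ σ τ ℓ₂ w) := fun w hw => by
      have hw' : ∀ j, 0 < affF 1 1 ((Fin.snoc M (τ • poleRow ℓ₂) : Fin (m' + 1) → _) j)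
          (normMap x₀ σ τ ℓ₂ w) := fun j => by rw [← affF_normF]; exact hw j
      have h := rows_snoc hw'
      rw [affF_smul'] at h
      exact h
    refine good_corner_norm (fun j => normL x₀ σ (L j)) e ℓ₁ far s'' _ (normP x₀ σ τ p) (normF x₀ σ τ ℓ₂ u) (normF x₀ σ τ ℓ₂ v)
      (normF x₀ σ τ ℓ₂ κ) A hbd'' hdom'' hint'' ?_ ?_ ?_ ?_ ?_
      (apex_map (normF_sub x₀ σ τ ℓ₂) (normF_smul x₀ σ τ ℓ₂) hA) hA0 ?_ ?_ ?_ ?_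
    · exact_mod_cast (show ((normF x₀ σ τ ℓ₂ u).2 : ℝ) = 0 by rw [normF_snd_cast x₀ σ τ ℓ₂ u z₀ hx₀R hy₀R, huz])
    · exact_mod_cast (show ((normF x₀ σ τ ℓ₂ v).2 : ℝ) = 0 by rw [normF_snd_cast x₀ σ τ ℓ₂ v z₀ hx₀R hy₀R, hvz])
    · exact_mod_cast (show ((normF x₀ σ τ ℓ₂ κ).2 : ℝ) = 0 by rw [normF_snd_cast x₀ σ τ ℓ₂ κ z₀ hx₀R hy₀R, hκz])
    · have h := normF_last x₀ σ τ ℓ₂ κ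
      rw [hlast] at h
      rw [h, hκ, mul_zero]
    · have h := normF_last x₀ σ τ ℓ₂ u
      rw [hlast] at h
      rw [h]
      exact mul_ne_zero hτ0 huy
    · intro w hw
      have h := hcell _ (hrows w hw).1
      simpa only [← affF_normF] using h
    · intro w hw
      have h := hσpos _ (hrows w hw).1
      rw [normMap_zero] at h
      have : (σ : ℝ) * ((x₀ : ℝ) + σ * w 0 - x₀) = σ * σ * w 0 := by ring
      rw [this, hσ', one_mul] at h
      exact h
    · intro w hw
      have h := (hrows w hw).2
      rw [affF_poleRow, affB_two, normMap_zero, normMap_one] at h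
      have : (τ : ℝ) * ((ℓ₂.1 0 : ℝ) * (x₀ + σ * w 0) + ℓ₂.2 + τ * w 1 - ((ℓ₂.1 0 : ℝ) * (x₀ + σ * w 0) + ℓ₂.2)) =
          τ * τ * w 1 := by ring
      rw [this, hτ', one_mul] at h
      exact h
    · intro j
      have h : (0 : ℝ) ≤ (normF x₀ σ τ ℓ₂ ((Fin.snoc M (τ • poleRow ℓ₂) : Fin (m' + 1) → _) j)).2 := by
        rw [normF_snd_cast x₀ σ τ ℓ₂ _ z₀ hx₀R hy₀R]
        refine Fin.lastCases ?_ (fun i => ?_) j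
        · rw [Fin.snoc_last, affF_smul', affF_poleRow, hyz, sub_self, mul_zero]
        · rw [Fin.snoc_castSucc]
          exact hM0 i
      exact_mod_cast h
  -- cut by the pole line
  have hg : poleRow ℓ₂ ≠ 0 := fun h => by
    have := congrArg (fun q : (Fin (1 + 1) → ℚ) × ℚ => q.1 1) h
    simp [poleRow] at this
  obtain ⟨s₁, s₂, hm₁, hm₂, hi₁, hi₂, hd₁, hd₂, hrel⟩ := cutBase s M _ _ hdom (poleRow ℓ₂) hg
  have hsub₁ : s₁.domain ⊆ s.domain := fun z hz => ((hm₁ z).1 hz).1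
  have hsub₂ : s₂.domain ⊆ s.domain := fun z hz => ((hm₂ z).1 hz).1
  refine good_of_split hrel (hside 1 s₁ (by norm_num) hsub₁ (by rw [one_smul]; exact hd₁) hi₁)
    (hside (-1) s₂ (by norm_num) hsub₂ (by rw [neg_one_smul]; exact hd₂) hi₂)

end DCorner

end RebasePos

/-- **Registered part of `stub_rebaseSimplePosOneZero` (line `janus-bands`): the residual
hypothesis `Hdthick` of `rebaseSimplePos_oneFibre_of_double'` at `b = 0`** (base `(x, y)`, one
lettered fibre with letter `0`, transverse bounds `u < t < v` above the `y`-free apex level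
`κ < 0`, `u − κ = A (v − u)`, `A > 0`, with a double corner — apex on the letter AND on the pole
line `y = ℓ₂(x)` at a point of the closed base cell): such a band is congruent modulo
`KZ.relations` to the subgroup generated by `GG 1 2 1` (`RebasePos.good_dcorner`: pole cut,
normalisation, box localisation, corner blow-ups; rules 1a and 2). -/
theorem rebaseSimplePos_dthick_one (m : ℕ) (L : Fin m → (Fin 1 → ℚ) × ℚ) (e : Fin m → ℕ) (ℓ₁ ℓ₂ : (Fin 1 → ℚ) × ℚ) (m' : ℕ) (s : KZ.IntegralRep (1 + 1 + 1)) (M : Fin m' → (Fin (1 + 1) → ℚ) × ℚ) (p : MvPolynomial (Fin 1) ℚ) (u v κ : (Fin (1 + 1) → ℚ) × ℚ) (A : ℚ) (hbd : Bornology.IsBounded s.domain) (hdom : s.domain = SeparatePos.gDom 1 1 m' M (fun _ => Sum.inr u) (fun _ => Sum.inr v)) (hint : EqOn s.integrand (RebasePos.glit 1 1 p L e ℓ₁ ℓ₂ 0 1 (fun _ => some 0)) s.domain) (hκ : κ.1 (Fin.last 1) = 0) (hA : u - κ = A • (v - u)) (hA0 : 0 < A) (hcell : ∀ z : Fin (1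 + 1 + 1) → ℝ, (∀ j, 0 < SeparatePos.affF 1 1 (M j) z) → SeparatePos.affF 1 1 κ z < 0 ∧ 0 < SeparatePos.affF 1 1 u z ∧ SeparatePos.affF 1 1 u z < SeparatePos.affF 1 1 v z) (hcorner : ∃ z ∈ closure {z : Fin (1 + 1 + 1) → ℝ | ∀ j, 0 < SeparatePos.affF 1 1 (M j) z}, SeparatePos.affF 1 1 κ z = 0 ∧ SeparatePos.affF 1 1 u z = 0 ∧ SeparatePos.affF 1 1 v z = 0 ∧ z (Fin.castAdd 1 (Fin.last 1)) = SeparatePos.affB 1 1 ℓ₂ z) : ∃ c ∈ AddSubgroup.closure (SeparatePos.GGset 1 2 1), KZ.of s - c ∈ KZ.relations :=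
  RebasePos.good_dcorner L e ℓ₁ ℓ₂ false s M p u v κ A hbd hdom hint hκ hA hA0 (fun z hz => hcell z hz) hcorner

/-- **Registered part of `stub_rebaseSimplePosOneZero` (line `janus-bands`): the residual
hypothesis `Hdfar` of `rebaseSimplePos_oneFibre_of_double'` at `b = 0`** (as
`rebaseSimplePos_dthick_one`, far regime `0 < κ`, `u < v`, `2κ ≤ v`). -/
theorem rebaseSimplePos_dfar_one (m : ℕ) (L : Fin m → (Fin 1 → ℚ) × ℚ) (e : Fin m → ℕ) (ℓ₁ ℓ₂ : (Fin 1 → ℚ) × ℚ) (m' : ℕ) (s : KZ.IntegralRep (1 + 1 + 1)) (M : Fin m' → (Fin (1 + 1) → ℚ) × ℚ) (p : MvPolynomial (Fin 1) ℚ) (u v κ : (Fin (1 + 1) → ℚ) × ℚ) (A : ℚ) (hbd : Bornology.IsBounded s.domain) (hdom : s.domain = SeparatePos.gDom 1 1 m' M (fun _ => Sum.inr u) (fun _ => Sum.inr v)) (hint : EqOn s.integrand (RebasePos.glit 1 1 p L e ℓ₁ ℓ₂ 0 1 (fun _ => some 0)) s.domain) (hκ : κ.1 (Fin.last 1) = 0)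 (hA : u - κ = A • (v - u)) (hA0 : 0 < A) (hcell : ∀ z : Fin (1 + 1 + 1) → ℝ, (∀ j, 0 < SeparatePos.affF 1 1 (M j) z) → 0 < SeparatePos.affF 1 1 κ z ∧ SeparatePos.affF 1 1 u z < SeparatePos.affF 1 1 v z ∧ 2 * SeparatePos.affF 1 1 κ z ≤ SeparatePos.affF 1 1 v z) (hcorner : ∃ z ∈ closure {z : Fin (1 + 1 + 1) → ℝ | ∀ j, 0 < SeparatePos.affF 1 1 (M j) z}, SeparatePos.affF 1 1 κ z = 0 ∧ SeparatePos.affF 1 1 u z = 0 ∧ SeparatePos.affF 1 1 v z = 0 ∧ z (Fin.castAdd 1 (Fin.last 1)) = SeparatePos.affB 1 1 ℓ₂ z) : ∃ c ∈ AddSubgroup.closure (SeparatePos.GGset 1 2 1), KZ.of s - c ∈ KZ.relations :=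
  RebasePos.good_dcorner L e ℓ₁ ℓ₂ true s M p u v κ A hbd hdom hint hκ hA hA0 (fun z hz => hcell z hz) hcorner

end Summit.KontsevichZagierPeriods.ArrangementNormalForm.JanusBands
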